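import Mathlib
import HarnessLib
import Literature.Analysis.FluidPDE.ClassicalSolution
import Literature.Analysis.FluidPDE.LerayHopf
import Literature.Analysis.FluidPDE.SuitableWeak
import Summits.NavierStokesRegularity.Statement
import Summits.NavierStokesRegularity.NavierStokesRegularity.Theses.QuarterJolt
import Summits.NavierStokesRegularity.NavierStokesRegularity.Theorems.QuarterJoltNoTerminalJoltRegularTime
import Summits.NavierStokesRegularity.NavierStokesRegularity.Theorems.QuarterJoltTypeIJoltLaw
import Summits.NavierStokesRegularity.NavierStokesRegularity.Theorems.NoBlowupToClay
import Summits.NavierStokesRegularity.NavierStokesRegularity.Theorems.BlowupAssembly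
import Summits.NavierStokesRegularity.NavierStokesRegularity.Theorems.AdiabaticEddyClayUniquenessCore

/-!
# Route QuarterJolt — crux `NoTerminalJolt` (stmt-NavierStokesRegularity-26463), LEAD line
# `regular_split`: the POSITION of the crux among the shelf statements, by name

Seat ns-ntj-p1 g2 (LEAD of the crux; `--supports 26463 --as helper`). Third file (after
`QuarterJoltTypeIFlatCell`, `QuarterJoltTypeIJoltLaw`): pure logic over landed theorems, recording as
KERNEL-CHECKED EQUIVALENCES what the route record so far carried as annotations («NTJ is a consequence
of S», route header; «summit-strength modulo EQL», director-ns KEY-NS #114 (1) / idea-crit-8 N33).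

Abbreviations in this docstring (each spelled out VERBATIM in the statements below — the tree has one
signature per shelf item and many route copies, so `exact` / `Iff.mp` serve every copy):
`NoBlowup` = stmt-0054 (every frame solution extends smoothly past `T`), `NoTypeII` = stmt-0056 (every
first blow-up in the frame is Type I), `NoTypeIBlowup` = stmt-1217 (a Type-I-rate solution in the frame
extends past `T`), `TypeIIJolt` = stub 3 of line `regular_split` rev 3 (a non-Type-I first blow-up has
no terminal jolt), `NTJ` = `Theses.QuarterJolt.NoTerminalJolt`, `EQL` = `Theses.QuarterJolt.EnstrophyQuarterLaw`.

* `NoTerminalJolt.of_noBlowup : NoBlowup → NTJ` and `NoTerminalJolt.of_navierStokesRegularity :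
  NavierStokesRegularity → NTJ` — the crux is ON PATH (a consequence of Clay (A)): by the regular-time
  half `noTerminalJolt_of_hasSmoothExtensionPast` (p619494) and Clay-class uniqueness
  (`blowup_clay_uniqueness` + `Literature.NS.blowup_assembly`, landed, route-independent).
* `NoTerminalJolt.iff_noTypeIBlowup_and_typeIIJolt : NTJ ↔ NoTypeIBlowup ∧ TypeIIJolt` — the
  reshaped skeleton `Cruxes/NoTerminalJolt/Lines/regular_split.lean` rev 3 loses nothing (Type-I
  terminal jolt law `typeI_terminalJoltLaw`, p629148).
* `NoTerminalJolt.iff_noBlowup_of_noTypeII : NoTypeII → (NTJ ↔ NoBlowup)` and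
  `NoTerminalJolt.iff_navierStokesRegularity_of_noTypeII : NoTypeII → (NTJ ↔ NavierStokesRegularity)`;
  `NoTerminalJolt.iff_navierStokesRegularity_of_enstrophyQuarterLaw : EQL → (NTJ ↔
  NavierStokesRegularity)` — N33 as a theorem, with EQL weakened to NoTypeII.

HONEST FRAMING: equivalences and implications between OPEN statements; nothing here proves
`NoTerminalJolt`, `EnstrophyQuarterLaw`, `NoTypeIBlowup`, `NoTypeII`, `NoBlowup` or Navier–Stokes
regularity, and this file claims no progress on them. No summit statement is proved here. Lint note:
the import of `QuarterJoltTypeIJoltLaw` inherits the known `theses-cone` advisory. [folklore]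
-/

noncomputable section

-- the summit and its single sub-problem share the name (CONVENTIONS §1), as in every Theorems file
set_option linter.dupNamespace false

namespace Summit.NavierStokesRegularity.NavierStokesRegularity.Theorems

open MeasureTheory Set Function Filter Topology
open scoped NNReal ENNReal
open Literature.Analysis.FluidPDE

namespace NoTerminalJolt

/-- **`NoBlowup ⇒ NoTerminalJolt`** (shelf statement stmt-0054 VERBATIM ⇒ the crux BY NAME): if every
frame solution extends smoothly past its `T`, every `T` is a regular time and the regular-time half
`noTerminalJolt_of_hasSmoothExtensionPast` (p619494) gives `D → 0`. [folklore] -/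
theorem of_noBlowup
    (h54 : ∀ (ν T : ℝ), 0 < ν → 0 < T →
      ∀ (u : ℝ → EuclideanSpace ℝ (Fin 3) → EuclideanSpace ℝ (Fin 3))
        (p : ℝ → EuclideanSpace ℝ (Fin 3) → ℝ),
        Literature.Analysis.FluidPDE.IsClassicalNSSolutionOn (Set.Ico 0 T) ν 0 u p →
        Literature.Analysis.FluidPDE.IsLerayHopfOn T ν 0 (u 0) u →
        Literature.Analysis.FluidPDE.HasRapidSpatialDecay (u 0) →
        Literature.Analysis.FluidPDE.HasSmoothExtensionPast ν 0 u T) :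
    Theses.QuarterJolt.NoTerminalJolt :=
  fun ν T hν hT u p hcl hLH hdec =>
    noTerminalJolt_of_hasSmoothExtensionPast hν hT hcl hLH hdec (h54 ν T hν hT u p hcl hLH hdec)

/-- **Clay (A) ⇒ NoBlowup** (stmt-0054 VERBATIM), route-independent packaging of the tree's
`Literature.NS.blowup_assembly` fed with the proved Clay-class uniqueness `blowup_clay_uniqueness`
(Tao 2013 Cor. 11.4): a maximal frame solution and Clay (A) are incompatible. (Same statement as
`HodographBetchov.noBlowup_of_navierStokesRegularity`, re-derived here to avoid importing that route's
cone.) [folklore] -/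
theorem noBlowup_of_navierStokesRegularity (hA : NavierStokesRegularity) :
    ∀ (ν T : ℝ), 0 < ν → 0 < T →
      ∀ (u : ℝ → EuclideanSpace ℝ (Fin 3) → EuclideanSpace ℝ (Fin 3))
        (p : ℝ → EuclideanSpace ℝ (Fin 3) → ℝ),
        Literature.Analysis.FluidPDE.IsClassicalNSSolutionOn (Set.Ico 0 T) ν 0 u p →
        Literature.Analysis.FluidPDE.IsLerayHopfOn T ν 0 (u 0) u →
        Literature.Analysis.FluidPDE.HasRapidSpatialDecay (u 0) →
        Literature.Analysis.FluidPDE.HasSmoothExtensionPast ν 0 u T := by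
  intro ν T hν hT u p hcl hLH hdec
  by_contra hext
  exact Literature.NS.blowup_assembly
    ⟨⟨ν, hν, T, hT, u, p, ⟨hcl, hext⟩, hLH, hdec⟩, blowup_clay_uniqueness⟩ hA

/-- **The crux is ON PATH: Clay (A) ⇒ NoTerminalJolt.** Kernel-hard form of the route header's «X2
is a consequence of S». [folklore] -/
theorem of_navierStokesRegularity (hA : NavierStokesRegularity) : Theses.QuarterJolt.NoTerminalJolt :=
  of_noBlowup (noBlowup_of_navierStokesRegularity hA)

/-- **`NoTerminalJolt ⟺ NoTypeIBlowup ∧ TypeIIJolt`** — exactness of the reshaped skeleton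
`Lines/regular_split.lean` rev 3: the crux BY NAME is equivalent to the conjunction of the shelf
statement stmt-1217 (VERBATIM) and the Type-II jolt statement (a NON-Type-I first blow-up in the frame
has no terminal jolt). `→`: `noTypeIBlowup_of_noTerminalJolt` (Type-I terminal jolt law) and dropping
hypotheses; `←`: case split regular time (`noTerminalJolt_of_hasSmoothExtensionPast`) / Type-I
blow-up (absurd) / non-Type-I blow-up. [folklore] -/
theorem iff_noTypeIBlowup_and_typeIIJolt :
    Theses.QuarterJolt.NoTerminalJolt ↔
      ((∀ (ν T : ℝ), 0 < ν → 0 < T →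
        ∀ (u : ℝ → EuclideanSpace ℝ (Fin 3) → EuclideanSpace ℝ (Fin 3))
          (p : ℝ → EuclideanSpace ℝ (Fin 3) → ℝ),
          Literature.Analysis.FluidPDE.IsClassicalNSSolutionOn (Set.Ico 0 T) ν 0 u p →
          Literature.Analysis.FluidPDE.IsLerayHopfOn T ν 0 (u 0) u →
          Literature.Analysis.FluidPDE.HasRapidSpatialDecay (u 0) →
          Literature.Analysis.FluidPDE.IsTypeIBlowup u T →
          Literature.Analysis.FluidPDE.HasSmoothExtensionPast ν 0 u T) ∧
      (∀ (ν T : ℝ), 0 < ν → 0 < T →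
        ∀ (u : ℝ → EuclideanSpace ℝ (Fin 3) → EuclideanSpace ℝ (Fin 3))
          (p : ℝ → EuclideanSpace ℝ (Fin 3) → ℝ),
          Literature.Analysis.FluidPDE.IsMaximalSmoothSolution ν 0 u p T →
          Literature.Analysis.FluidPDE.IsLerayHopfOn T ν 0 (u 0) u →
          Literature.Analysis.FluidPDE.HasRapidSpatialDecay (u 0) →
          ¬ Literature.Analysis.FluidPDE.IsTypeIBlowup u T →
          Filter.Tendsto (fun t : ℝ => (Real.sqrt (T - t))⁻¹ * ∫ x, ‖u t x - u T x‖ ^ 2)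
            (nhdsWithin T (Set.Iio T)) (nhds 0))) := by
  refine ⟨fun h => ⟨noTypeIBlowup_of_noTerminalJolt h,
    fun ν T hν hT u p hmax hLH hdec _ => h ν T hν hT u p hmax.1 hLH hdec⟩, fun h => ?_⟩
  obtain ⟨h1217, hII⟩ := h
  intro ν T hν hT u p hcl hLH hdec
  by_cases hext : HasSmoothExtensionPast ν 0 u T
  · exact noTerminalJolt_of_hasSmoothExtensionPast hν hT hcl hLH hdec hext
  · by_cases hTI : IsTypeIBlowup u T
    · exact absurd (h1217 ν T hν hT u p hcl hLH hdec hTI) hext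
    · exact hII ν T hν hT u p ⟨hcl, hext⟩ hLH hdec hTI

/-- **`NoTypeII ⇒ (NoTerminalJolt ⟺ NoBlowup)`** (stmt-0056 VERBATIM as hypothesis; stmt-0054
VERBATIM on the right): if every first blow-up in the frame is Type I, the crux is EQUIVALENT to the
absence of blow-up — `→` by `noBlowup_of_noTypeII_of_noTerminalJolt` (Type-I terminal jolt law), `←`
by `of_noBlowup`. [folklore] -/
theorem iff_noBlowup_of_noTypeII
    (h56 : ∀ (ν T : ℝ), 0 < ν → 0 < T →
      ∀ (u : ℝ → EuclideanSpace ℝ (Fin 3) → EuclideanSpace ℝ (Fin 3))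
        (p : ℝ → EuclideanSpace ℝ (Fin 3) → ℝ),
        Literature.Analysis.FluidPDE.IsMaximalSmoothSolution ν 0 u p T →
        Literature.Analysis.FluidPDE.IsLerayHopfOn T ν 0 (u 0) u →
        Literature.Analysis.FluidPDE.HasRapidSpatialDecay (u 0) →
        Literature.Analysis.FluidPDE.IsTypeIBlowup u T) :
    Theses.QuarterJolt.NoTerminalJolt ↔
      (∀ (ν T : ℝ), 0 < ν → 0 < T →
        ∀ (u : ℝ → EuclideanSpace ℝ (Fin 3) → EuclideanSpace ℝ (Fin 3))
          (p : ℝ → EuclideanSpace ℝ (Fin 3) → ℝ),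
          Literature.Analysis.FluidPDE.IsClassicalNSSolutionOn (Set.Ico 0 T) ν 0 u p →
          Literature.Analysis.FluidPDE.IsLerayHopfOn T ν 0 (u 0) u →
          Literature.Analysis.FluidPDE.HasRapidSpatialDecay (u 0) →
          Literature.Analysis.FluidPDE.HasSmoothExtensionPast ν 0 u T) :=
  ⟨fun h => noBlowup_of_noTypeII_of_noTerminalJolt h56 h, of_noBlowup⟩

/-- **`NoTypeII ⇒ (NoTerminalJolt ⟺ Clay (A))`** (stmt-0056 VERBATIM as hypothesis): given that every
first blow-up in the frame is Type I, the crux is EQUIVALENT to `NavierStokesRegularity`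
(`navierStokesRegularity_of_noBlowup`, stmt-0055, and `of_navierStokesRegularity`). The director's
annotation «summit-strength modulo EQL» (KEY-NS #114 (1), idea-crit-8 N33) with EQL weakened to
NoTypeII. Conditional on the OPEN statement 0056; nothing is asserted about it. [folklore] -/
theorem iff_navierStokesRegularity_of_noTypeII
    (h56 : ∀ (ν T : ℝ), 0 < ν → 0 < T →
      ∀ (u : ℝ → EuclideanSpace ℝ (Fin 3) → EuclideanSpace ℝ (Fin 3))
        (p : ℝ → EuclideanSpace ℝ (Fin 3) → ℝ),
        Literature.Analysis.FluidPDE.IsMaximalSmoothSolution ν 0 u p T →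
        Literature.Analysis.FluidPDE.IsLerayHopfOn T ν 0 (u 0) u →
        Literature.Analysis.FluidPDE.HasRapidSpatialDecay (u 0) →
        Literature.Analysis.FluidPDE.IsTypeIBlowup u T) :
    Theses.QuarterJolt.NoTerminalJolt ↔ NavierStokesRegularity :=
  ⟨fun h => navierStokesRegularity_of_noBlowup (noBlowup_of_noTypeII_of_noTerminalJolt h56 h),
    of_navierStokesRegularity⟩

/-- **`EnstrophyQuarterLaw ⇒ (NoTerminalJolt ⟺ Clay (A))`** (the route's other crux BY NAME): under
the quarter law every first blow-up is Type I (`noTypeII_of_enstrophyQuarterLaw`, by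
`RecordTimeTypeI.main`), so the previous equivalence applies. This is exactly the record's annotation
«26463 is summit-strength modulo EQL (1574)» as a kernel-checked theorem. Conditional on the OPEN
crux EQL; no summit statement is proved. [folklore] -/
theorem iff_navierStokesRegularity_of_enstrophyQuarterLaw
    (hQ : Theses.QuarterJolt.EnstrophyQuarterLaw) :
    Theses.QuarterJolt.NoTerminalJolt ↔ NavierStokesRegularity :=
  iff_navierStokesRegularity_of_noTypeII (noTypeII_of_enstrophyQuarterLaw hQ)

end NoTerminalJolt

end Summit.NavierStokesRegularity.NavierStokesRegularity.Theorems

end
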